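import Literature.MathematicalPhysics.QuantumFieldTheory.Balaban1983to89.B8Ineq145LineageCStar
import Literature.MathematicalPhysics.QuantumFieldTheory.Balaban1983to89.B8Prop7TowerAxialRecord
import Literature.MathematicalPhysics.QuantumFieldTheory.Balaban1983to89.Node00.CarriersB8SubBP2C
import Literature.MathematicalPhysics.QuantumFieldTheory.Balaban1983to89.B8LeafKnitRS

/-!
# `Balaban1983to89.B8Prop7PrintedRZdGF3P2HalfSpaceCStar` — THE P₇-CURRENCY NECESSITY CERTIFICATE IN EVERY COEFFICIENT C⋆-ALGEBRA: [Balaban1985RegularSpaces]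
# Proposition 7 AS TYPED-PRINTED (`B8SectGH.Prop7PrintedR`, constant `2α₂` in (1.145)) is FALSE on NODE 00's δ₂ ∕ P-carriers `zdGF3HP₂` ∕ `zdGF3P₂` ∕ `zdGF3HP` ∕ `zdGF3P`
# with print's PINNED tower-wise axial map `toAxialTower`, at the lawful admissible half-space member, for EVERY nontrivial C⋆-algebra `𝔸` (e.g. `M_N(ℂ)`), `d = 4`,
# EVERY `L ≥ 3` — hence at EVERY record `θ : Node00.Stage3Params` with `θ.D = 4` the K1 knits' `p7` binder with the map pinned is FALSE

statement-level skeleton of published theorems with citation tags; proofs where landed; nothing here is a claim about the Yang–Mills mass gap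

T. Bałaban, *Spaces of regular gauge field configurations on a lattice and gauge fixing conditions*, Commun. Math. Phys. **99** (1985) 75–102
`[Balaban1985RegularSpaces]` ("B8"; journal page = PDF page + 74): Prop. 7 (1.143)–(1.145) p. 100, (1.139)–(1.140) p. 100, (1.29)–(1.31) pp. 81–82, (1.35) p. 82,
(1.3)–(1.6) p. 77, p. 77 (bond convention), Lemma 1 – Thm 8 pp. 79–101; cell GAPS G-B8-01.  [3] = `[Balaban1985Averaging]`, (21) p. 21, (42)–(43) pp. 23–24, (69) p. 29,
(76)–(77), (82), (85)–(87), (89)–(90) pp. 29–31, (110) p. 34, (127) p. 37.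

## WHY THIS FILE (cell `pub-ymgap`, HUMAN RULING D-0062 ∕ D-0149 ∕ D-0154; N05 = [B8]; width seat `pub-ymgap-dag-n05-w5` g2, piece (B) of its CLAIM-1 (bus 2026-08-28T06:12Z);
## located by this seat's g0 (`B8Prop7PrintedRZdGF3P2HalfSpaceAllL` HONEST SCOPE «general `θ.𝔸` … UNOWNED»), by referee dag-ref-P g1 (READ of p607226), route co-located by dag-n05-w2 g3)

The certificate chain r05 `B8Ineq145Lineage` (crossing-bond witness) → n05-w2 `B8Prop7PrintedRZdGF3P2HalfSpace` (NODE 00's δ₂ carrier, pinned map, lawful admissible member, `L = 3`)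
→ g0 `…AllL` (every `L ≥ 3`) fixes the coefficient algebra `𝔸 = ℂ` (the flat abelian witness `U₀ = 1`, `U₁ ≡ e^{iθ}`).  NODE 00's records carry a GENERAL coefficient
C⋆-algebra `θ.𝔸` (`Node00.Stage2Params.𝔸`; print: `M_N(ℂ)`), so the record-keyed face `¬ Prop7PrintedR (famB8OfRecordSubBP₂C θ β len ·) (toAxialTowerResid θ β len ·)` at an
ARBITRARY `θ` needs the witness INSIDE `θ.𝔸`.  No functorial transport of the averaging ∕ gauge-fixing operations is needed: r05's §1 (`hol_cst`, `bavg_cst`, …), §3 (`u8`)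
and §4 (`tildIter_u8_crossing` ∕ `avgIter_u8_crossing` — «every background, every `U₁`, no smallness, no commutativity»), n05-w2's §§1–2 (`exists_halfspace_member_lawsB`,
`uTower_lam_eq_u8`) and NODE 00's `mlogCfg_spec` ∕ `uTower_facts` ∕ `toAxialTower_of_unitary` ∕ `cfgExp_mem_unitaryUnits` are ALREADY `𝔸`-general; only r05's §2 ∕ §5
(«Scalar ∕ Witness») fix `ℂ`, and the companion file `B8Ineq145LineageCStar` re-runs them for the CENTRAL SCALAR UNIT `c = e^{iθ}·1 = expUnit (algebraMap ℂ 𝔸 (iθ))` of any nontrivial C⋆-algebra: the series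
logarithm of `cⁿ` is `inθ·1` (`B7BlockAvgLog.mlog_exp`, `‖iφ·1‖ = |φ|` by `norm_algebraMap'`), the block frames are central and cancel (`Algebra.commute_algebraMap_left`),
`‖c − 1‖ = 2|sin(θ∕2)|` (`NormedSpace.algebraMap_exp_comm`), and the `d = 4` arithmetic is g0's `flat_witness_exceeds_allL` BY NAME.

## WHAT IS PROVED (kernel, 0 sorry; theorems only)

* (The witness arithmetic in a general `𝔸` is the companion file `B8Ineq145LineageCStar`; its `ineq145_fails_algebraMap_allL` is USED here.)
* §1 ★★ `not_prop7PrintedR_zdGF3HP₂_toAxialTower_halfspace_cstar (𝔸) (L) (hL : 3 ≤ L) (hL1 : 1 ≤ L) (β) (len)`: `∃ i : ZdIdx 4 L`, lawful (`IdxB8LawsB`), admissible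
  (`DomainSeq`), `i.Ω 0 = univ`, `i.Ω = OmegaHS 0`, with `¬ B8SectGH.Prop7PrintedR (fun _ : Unit => zdGF3HP₂ 𝔸 L β len i) (fun _ => toAxialTower 𝔸 L β len hL1 i)`;
  the `zdGF3P₂` ∕ `zdGF3HP` ∕ `zdGF3P` faces (the six fields Proposition 7 reads agree by `rfl`); the `d`-keyed form `…_cstar_dim (hd : d = 4)` a record reads at `d := θ.D`.
* §2 THE RECORD FACES AT EVERY `θ : Node00.Stage3Params` WITH `θ.D = 4` (any `θ.𝔸`; `3 ≤ θ.L` from `Odd L ∧ 1 < L`): ★ `exists_idxB8SubC_not_prop7PrintedR` ·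
  ★★ `not_prop7PrintedR_famB8OfRecordSubBP_toAxialTowerResid` — the K1 record knits' `p7` binder `Prop7PrintedR (fun j : IdxB8SubB θ => famB8OfRecordSubBP θ β len j)
  (fun j => λ.toAxial j.1)` with `λ.toAxial` PINNED to print's map (`toAxialTowerResid θ β len`) is FALSE · ★★ `not_prop7PrintedR_famB8OfRecordSubBP₂C_toAxialTowerResid` (the «P₂C»
  slot's index `IdxB8SubC θ`) · `not_prop7PrintedR_famB8OfRecordSubBP_domainSeq_toAxialTowerResid` (n05-w1's admissible subtype) · ★ `not_b8LeafRS_famB8OfRecordSubBP₂C_toAxialTowerResid`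
  ∕ `not_b8LeafRS_famB8OfRecordSubBP_toAxialTowerResid` — for ALL residual constants and carriers, the RS-currency leaf `B8LeafKnitRS.B8LeafRS` over the pinned P₂C ∕ P data
  is uninhabited (the hypothesis of `Node00.CarriersB8SubBP2C.b8LeafOfRecordSubBP₂C_of_b8LeafRS_pinned` has no instance at any such `θ`).

## HONEST SCOPE

NEGATIVE certificates about a proof CURRENCY (the typed-printed constant `2α₂` of (1.145) for print's PINNED tower-wise axial map), now independent of the coefficient
algebra; by r05's kernel witness (G-B8-01: one block of accumulated axial phase across `∂Λ₁`) embedded along `algebraMap ℂ 𝔸`.  NO estimate of [Balaban1985RegularSpaces]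
is proved or denied; nothing is said against the REPAIRED currency `B8Ineq145.Prop7RepairedC (c₇OfRecord θ)` in which the «P₂C» slot is typed (`prop7_famB8OfRecordSubBP₂C` HOLDS),
nor about a free (unpinned) `λ.toAxial` (`B8Prop7GlevZd3P.prop7PrintedR_zdGF3HP_unitAxial_comp`: a junk map makes the typed sentence true), nor about the BOX-FORM (1.35)
letter of the members `zdGF3` ∕ `zdGF3H` (`famB8OfRecord` ∕ `…SubB` ∕ `…SubBH`: their `avgClose` guard «both end-blocks in `Ω_j`» excludes the crossing bonds, so this witness does
not speak to them).  `θ.D = 4` is a hypothesis (print's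
dimension; the `d = 4` arithmetic of `flat_witness_exceeds_allL`); other `D` are not treated.  Count-neutral helper keyed `stmt-QuantumFields-20542` (K1⁷); N05 NOT discharged;
no count claim; `T_η ↦ ℤᵈ`; one finite `𝕋⁴` programme at fixed `ε`, Bałaban AS PRINTED; the Yang–Mills mass gap (Clay) is NOT proved by any of this — R4 closes the
conditional finite-`𝕋⁴` rung `BalabanLadder.UV` only; nothing continuum ∕ ℝ⁴ ∕ OS.  No `sorry`, no `def`, no `instance`, no `notation`.  Unit `pub-ymgap-dag-n05-w5` (g2), 2026-08-28.

RELATED, NOT DUPLICATED: `B8Ineq145Lineage` (r05: §§1,3,4 USED by name; §§2,5 are the `ℂ` case of §1 here), `B8Prop7PrintedRZdGF3P2HalfSpace` ∕ `…AllL` (the `𝔸 = ℂ` certificate;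
§1 here is its proof re-run at `algebraMap ℂ 𝔸 (Lθ)`, not a consequence of it), `B8Prop7PrintedRTowerAxialRecordP` (the faces at the two `ℂ`-dictionaries of record, by `rfl`),
`B8Prop7TowerAxialRecord` ∕ `…RecordP` ∕ `Node00.CarriersB8SubBP2C` (the POSITIVE repaired-currency faces), `B7BlockAvgLog` (`mlog_exp`), `B8LeafKnit.prop7PrintedR_precomp`.

[cite: Balaban1985RegularSpaces, Prop. 7 (1.143)–(1.145) p.100, (1.139)–(1.140) p.100, (1.29)–(1.31) pp.81–82, (1.35) p.82, (1.3)–(1.6) p.77, p.77; Balaban1985Averaging, (21) p.21, (42)–(43) pp.23–24, (69) p.29, (76)–(77) pp.29–30, (82) p.30, (85)–(87) p.31, (89)–(90) p.31, (110) p.34, (127) p.37]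
-/

noncomputable section

open NormedSpace Finset

namespace Literature.MathematicalPhysics.QuantumFieldTheory.Balaban1983to89.B8Prop7PrintedRZdGF3P2HalfSpaceCStar

open Complex (I)
open B7Prop1Explicit B7Prop1Local B7Prop2Explicit B7Eq92Concrete B7Eq84Concrete
open B8Ineq130 (tlo thi tlo_apply thi_apply)
open B8Ineq132 (Under InAk covDerivFwd)
open B8Eq140Level (SideTouches)
open B8Eq143PlaqExpansion (pdiv)
open B8Eq146AExpansion (plaqCovDeriv plaqCovDeriv_eq_covDerivFwd)
open B8Eq184Proof (cfgExp)
open B8Lemma1NonAbelian (mulCfg)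
open B8Thm4Concrete (mulCfg_eq_mul)
open B7Eq78Linearization (conjR conjR_apply)
open B8Prop6OfThm4 (one_inAk)
open B8IdxB8LawsB (IdxB8LawsB IdxB8SubB)
open B8ConstraintBonds (DomainSeq)
open B8LeafModelZd (ZdIdx)
open B8LeafModelZd3 (zdGF3 mlogCfg mlogCfg_spec)
open B8LeafModelZd3P (zdGF3P zdGF3HP EndBlockIn)
open B8LeafModelZd3P2 (zdGF3P₂ zdGF3HP₂)
open B8Prop7TowerAxialZd3 (uTower toAxialTower toAxialTower_of_unitary)
open B8Prop7TowerAxialUnitary (uTower_facts)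
open B8Prop7TowerAxialRecord (toAxialTowerResid)
open B8Ineq145Lineage (u8)
open B8Prop7HalfSpace (OmegaHS omegaHS_zero omegaHS_one sideTouches_omegaHS_zero)
open B8Prop7PrintedRZdGF3P2HalfSpace (exists_halfspace_member_lawsB uTower_lam_eq_u8)
open B8Ineq145LineageCStar (ineq145_fails_algebraMap_allL)
open B9SupplySockB9P3ZdSocketBoundaryMode (cfgExp_mem_unitaryUnits)
open B8LeafKnit (prop7PrintedR_precomp)
open B8LeafKnitRS (B8LeafRS)
open Node00 (Stage3Params IdxB8 famB8OfRecord IdxB8SubC famB8OfRecordSubBP₂C famB8OfRecordSubBP)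

-- `Site` alone could resolve to the torus sites of `Setup.lean`; re-export the `ℤ^d` sites of `B7Prop1Explicit`.
export B7Prop1Explicit (Site)

variable {d : ℕ} {𝔸 : Type} [CStarAlgebra 𝔸] [Nontrivial 𝔸]

omit [Nontrivial 𝔸] in
/-- Real scalars act through `algebraMap`: `r • (z·1) = (rz)·1`. [folklore] -/
private theorem real_smul_algebraMap (r : ℝ) (z : ℂ) : r • algebraMap ℂ 𝔸 z = algebraMap ℂ 𝔸 ((r : ℂ) * z) := by
  rw [← Complex.coe_smul, Algebra.smul_def, map_mul]

/-! ## §1 The typed-printed Proposition 7 FAILS on the δ₂ carrier with the pinned map at the half-space member, EVERY nontrivial C⋆-algebra, EVERY `L ≥ 3` -/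

section Printed

variable (𝔸)

/-- ★★ **THE TYPED-PRINTED PROPOSITION 7 (`B8SectGH.Prop7PrintedR`, constant `2α₂`) IS FALSE ON NODE 00's δ₂ CARRIER `zdGF3HP₂ 𝔸` WITH PRINT'S PINNED TOWER-WISE MAP
`toAxialTower`, AT THE LAWFUL ADMISSIBLE HALF-SPACE MEMBER, FOR EVERY NONTRIVIAL C⋆-ALGEBRA `𝔸` AND EVERY BLOCK SIZE `L ≥ 3`** (`d = 4`, any `β`, `len`): for every
threshold `c > 0` the data `α₀ = α₂ = min{c, 1∕16, c(4,L)}`, `U₀ = 1`, `U₁ = e^{iηA}`, `η = 1∕L`, `A ≡ Lθ·1` (central, self-adjoint), `Lθ = (27∕28)α₂` satisfy (1.33) `InA`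
(`one_inAk`) and the carrier's honest (1.140) `C140` (the canonical `mlogCfg` is `A` by `mlogCfg_spec`; flat background, constant field: all covariant derivatives vanish), the map
is in its unitary regime (`uTower_facts`, so `U′ = U₁^{uTower}` with `uTower = u8`, `uTower_lam_eq_u8`), and the conclusion (1.145) ↦ `avgClose (2α₂)` in the one-end-point class
fails at the level-`1` bond `⟨y, y + e₀⟩`, `y₀ = −1` (`B¹(y + e₀) ⊂ Ω₁`): `ineq145_fails_algebraMap_allL` gives `2α₂ <` the left member.  The `𝔸 = ℂ` instance is g0's
`B8Prop7PrintedRZdGF3P2HalfSpaceAllL.not_prop7PrintedR_zdGF3HP₂_toAxialTower_halfspace_allL` (same proof at `ℂ`).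
[cite: Balaban1985RegularSpaces, Prop. 7 (1.143)–(1.145) p.100, (1.35) p.82, p.77, (1.3)–(1.4) p.77; Balaban1985Averaging, (76)–(77) pp.29–30, (87) p.31] -/
theorem not_prop7PrintedR_zdGF3HP₂_toAxialTower_halfspace_cstar (L : ℕ) (hL : 3 ≤ L) (hL1 : 1 ≤ L) (β : ℝ) (len : Site 4 → ℝ) :
    ∃ i : ZdIdx 4 L, IdxB8LawsB L i ∧ DomainSeq L i.Ω ∧ i.Ω 0 = Set.univ ∧ i.Ω = OmegaHS (0 : Fin 4) ∧
      ¬ B8SectGH.Prop7PrintedR (fun _ : Unit => zdGF3HP₂ 𝔸 L β len i) (fun _ => toAxialTower 𝔸 L β len hL1 i) := by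
  have hL2 : 2 ≤ L := le_trans (by norm_num) hL
  have hLr : (1 : ℝ) ≤ L := by exact_mod_cast hL1
  have hL0 : (L : ℝ) ≠ 0 := by linarith
  have hLpos : (0 : ℝ) < L := by linarith
  obtain ⟨i, hik, hiη, hΩ, hΛ, -, hlaws, hadm⟩ := exists_halfspace_member_lawsB (d := 4) hL1 (0 : Fin 4)
  have hΩ0 : i.Ω 0 = Set.univ := by rw [hΩ]; exact omegaHS_zero 0
  refine ⟨i, hlaws, hadm, hΩ0, hΩ, ?_⟩
  rintro ⟨c, hc, H⟩
  -- the smallness parameters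
  set α₂ : ℝ := min c (min (1 / 16) (B8Prop7AdmittedFamily.cst 4 L)) with hα₂
  have hcst : 0 < B8Prop7AdmittedFamily.cst 4 L := B8Prop7AdmittedFamily.cst_pos (by norm_num) L hL1
  have h0 : 0 < α₂ := lt_min hc (lt_min (by norm_num) hcst)
  have hc2 : α₂ ≤ c := min_le_left _ _
  have h16 : α₂ ≤ 1 / 16 := (min_le_right _ _).trans (min_le_left _ _)
  have hcs : α₂ ≤ B8Prop7AdmittedFamily.cst 4 L := (min_le_right _ _).trans (min_le_right _ _)
  have h6 : α₂ ≤ 1 / 6 := h16.trans (by norm_num)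
  set θ : ℝ := 27 / 28 * α₂ / L with hθdef
  have hθ : (L : ℝ) * θ = 27 / 28 * α₂ := by rw [hθdef, mul_div_assoc', mul_div_cancel_left₀ _ hL0]
  have hLθpos : 0 < (L : ℝ) * θ := by rw [hθ]; positivity
  have hθpos : 0 < θ := by rw [hθdef]; positivity
  -- the data on the member: `η = 1∕L`, `U₀ = 1`, `U₁ = e^{iηA}`, `A ≡ Lθ·1`
  have hη : i.η = (L : ℝ)⁻¹ := hiη
  let A : Site 4 → Fin 4 → 𝔸 := fun _ _ => algebraMap ℂ 𝔸 ((((L : ℝ) * θ : ℝ)) : ℂ)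
  have hAh : ∀ (y : Site 4) (κ : Fin 4), IsSelfAdjoint (A y κ) := fun _ _ => by
    show IsSelfAdjoint (algebraMap ℂ 𝔸 ((((L : ℝ) * θ : ℝ)) : ℂ))
    refine IsSelfAdjoint.algebraMap 𝔸 ?_
    show star ((((L : ℝ) * θ : ℝ)) : ℂ) = (((L : ℝ) * θ : ℝ) : ℂ)
    rw [Complex.star_def, Complex.conj_ofReal]
  have hnormA : ∀ (y : Site 4) (κ : Fin 4), ‖A y κ‖ = (L : ℝ) * θ := fun _ _ => by
    show ‖algebraMap ℂ 𝔸 ((((L : ℝ) * θ : ℝ)) : ℂ)‖ = (L : ℝ) * θ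
    rw [norm_algebraMap', Complex.norm_real, Real.norm_eq_abs, abs_of_pos hLθpos]
  let U₀ : (zdGF3HP₂ 𝔸 L β len i).Cfg := ⟨1, fun _ _ => (unitaryUnits 𝔸).one_mem⟩
  let U₁ : {U : Site 4 → Fin 4 → 𝔸ˣ // ∀ x κ, U x κ ∈ unitaryUnits 𝔸} :=
    ⟨cfgExp i.η A, fun x κ => cfgExp_mem_unitaryUnits i.η hAh x κ⟩
  let P : (zdGF3HP₂ 𝔸 L β len i).Pert := (U₀, U₁)
  have hU₁ : (P.2.1 : Site 4 → Fin 4 → 𝔸ˣ) = B8Ineq145Lineage.cst (expUnit (algebraMap ℂ 𝔸 (I * (θ : ℂ)))) := by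
    funext x κ
    show expUnit (I • (i.η • algebraMap ℂ 𝔸 ((((L : ℝ) * θ : ℝ)) : ℂ))) = expUnit (algebraMap ℂ 𝔸 (I * (θ : ℂ)))
    have hL0' : (L : ℂ) ≠ 0 := by exact_mod_cast (show (L : ℕ) ≠ 0 by omega)
    rw [hη, real_smul_algebraMap, Algebra.smul_def, ← map_mul]
    congr 2
    push_cast
    field_simp
  -- (1.33) for `U₀ = 1`
  have hInA : (zdGF3 𝔸 L β len i).InA α₂ U₀ := by
    show InAk L i.k i.η α₂ i.Ω (1 : Site 4 → Fin 4 → 𝔸ˣ)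
    exact one_inAk hL1 i.k i.hη h0 i.Ω
  -- (1.140) in the carrier's honest body: the canonical masked logarithm is `A`
  have hall : ∀ (y : Site 4) (τ : Fin 4), SideTouches (i.Ω 0) y τ := fun y τ => by
    rw [hΩ]; exact sideTouches_omegaHS_zero (by norm_num) 0 y τ
  -- the two weights `(L^j η)⁻¹`, `j = 0, 1`, at `η = 1/L`
  have hw0 : ((L : ℝ) ^ 0 * i.η)⁻¹ = L := by rw [hη, pow_zero, one_mul, inv_inv]
  have hw1 : ((L : ℝ) ^ 1 * i.η)⁻¹ = 1 := by rw [hη, pow_one, mul_inv_cancel₀ hL0, inv_one]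
  have hv0 : (L : ℝ) ^ 0 * i.η = (L : ℝ)⁻¹ := by rw [hη, pow_zero, one_mul]
  have hv1 : (L : ℝ) ^ 1 * i.η = 1 := by rw [hη, pow_one, mul_inv_cancel₀ hL0]
  have hWA : ∀ j, j ≤ i.k → ∀ (y : Site 4) (τ : Fin 4), SideTouches (i.Ω j) y τ →
      P.2.1 y τ = cfgExp i.η A y τ ∧ ‖A y τ‖ ≤ α₂ * ((L : ℝ) ^ j * i.η)⁻¹ := by
    intro j hj y τ _
    refine ⟨rfl, ?_⟩
    rw [hik] at hj
    rw [hnormA y τ]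
    interval_cases j
    · rw [hw0, hθ]; nlinarith
    · rw [hw1, hθ]; linarith
  obtain ⟨hmsa, hmeq, -⟩ := mlogCfg_spec (W := P.2.1) i.hη hL1 i.k (1 : Site 4 → Fin 4 → 𝔸ˣ) P.2.2 h0.le
    (by linarith) i.Ω hWA
  have hmA : mlogCfg i.k i.η i.Ω P.2.1 = A := by
    funext y τ
    exact (hmeq 0 (Nat.zero_le _) y τ (hall y τ)).1
  have hgrad1 : ∀ (κ τ : Fin 4) (y : Site 4), covDerivFwd i.η (1 : Site 4 → Fin 4 → 𝔸ˣ) κ (fun z => A z τ) y = 0 :=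
    fun κ τ y => by simp [A, covDerivFwd, conjR_apply]
  have hplaq1 : plaqCovDeriv i.η (1 : Site 4 → Fin 4 → 𝔸ˣ) A = fun _ _ _ => 0 := by
    funext μ ν x
    rw [plaqCovDeriv_eq_covDerivFwd, hgrad1 μ ν x, hgrad1 ν μ x, sub_zero]
  have hdiv1 : ∀ (μ : Fin 4) (y : Site 4), pdiv i.η (1 : Site 4 → Fin 4 → 𝔸ˣ) (plaqCovDeriv i.η 1 A) μ y = 0 := by
    intro μ y
    rw [hplaq1]
    simp [pdiv, B8Ineq132.covDeriv, conjR_apply]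
  have hgrad : ∀ (κ τ : Fin 4) (y : Site 4), covDerivFwd i.η U₀.1 κ (fun z => A z τ) y = 0 := hgrad1
  have hdiv : ∀ (μ : Fin 4) (y : Site 4), pdiv i.η U₀.1 (plaqCovDeriv i.η U₀.1 A) μ y = 0 := hdiv1
  have h140 : (zdGF3 𝔸 L β len i).C140 α₂ U₀ P := by
    intro j hj y τ hst
    rw [hmA]
    rw [hik] at hj
    refine ⟨rfl, hAh y τ, ?_, fun κ => ?_, ?_⟩
    · rw [hnormA y τ]
      interval_cases j
      · rw [hv0, inv_mul_cancel_left₀ hL0 θ]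
        have hθle : θ ≤ 27 / 28 * α₂ := by
          rw [← hθ]; nlinarith
        linarith
      · rw [hv1, one_mul, hθ]; linarith
    · rw [hgrad κ τ y, norm_zero, mul_zero]; exact h0
    · rw [hdiv τ y, norm_zero, mul_zero]; exact h0
  -- the map is in its unitary regime: `U′ = U₁^{uTower}`, `uTower = u8`
  have hunit := fun x => (uTower_facts (𝔸 := 𝔸) (β := β) (len := len) (by norm_num : 2 ≤ 4) hL2 i hΩ0
    h0 hcs h0 hcs U₀ P hInA h140 x).1
  have hTA := toAxialTower_of_unitary (𝔸 := 𝔸) (β := β) (len := len) hL1 i U₀ P hunit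
  -- the conclusion (1.145) at the crossing bond
  obtain ⟨-, havg⟩ := H () α₂ α₂ h0 hc2 h0 hc2 U₀ P hInA h140
  let y : Site 4 := fun j => if j = 0 then -1 else 0
  have hy : y 0 = -1 := by simp [y]
  have hend : EndBlockIn L (i.Ω 1) 1 y 0 := by
    refine Or.inr fun x hx => ?_
    rw [hΩ, omegaHS_one]
    show 0 ≤ x 0
    have h1 := (hx 0).1
    rw [tlo_apply, pow_one] at h1
    simp only [Pi.add_apply, e_apply, if_true, y] at h1
    simpa using h1
  have hle := havg 1 (by rw [hik]) y 0 hend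
  dsimp only at hle
  rw [hTA] at hle
  -- rewrite the member's data into r05's letters
  have hLHS : (avgIter L (mulCfg (mgauge U₀.1 (uTower L hL1 i.k (i.Λs i.k) U₀.1 P.2.1) P.2.1) U₀.1) 1 y 0 : 𝔸)
      = (avgIter L (mgauge 1 (u8 L hL1 (0 : Fin 4) 1 (B8Ineq145Lineage.cst (expUnit (algebraMap ℂ 𝔸 (I * (θ : ℂ))))))
          (B8Ineq145Lineage.cst (expUnit (algebraMap ℂ 𝔸 (I * (θ : ℂ))))) * (1 : Site 4 → Fin 4 → 𝔸ˣ)) 1 y 0 : 𝔸) := by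
    rw [mulCfg_eq_mul, hik, hΛ, uTower_lam_eq_u8, hU₁]
  have hlt := ineq145_fails_algebraMap_allL (𝔸 := 𝔸) hL hL1 (0 : Fin 4) h0 h6 hθ y hy
  have hle' : ‖(avgIter L (mulCfg (mgauge U₀.1 (uTower L hL1 i.k (i.Λs i.k) U₀.1 P.2.1) P.2.1) U₀.1) 1 y 0 : 𝔸)
      - (avgIter L U₀.1 1 y 0 : 𝔸)‖ ≤ 2 * α₂ := hle
  rw [hLHS] at hle'
  exact lt_irrefl _ (hle'.trans_lt hlt)

/-- The same on the `zdGF3P₂` face (the fields Proposition 7 reads are `rfl`-equal), every nontrivial C⋆-algebra, every `L ≥ 3`.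
[cite: Balaban1985RegularSpaces, Prop. 7 (1.144)–(1.145) p.100] -/
theorem not_prop7PrintedR_zdGF3P₂_toAxialTower_halfspace_cstar (L : ℕ) (hL : 3 ≤ L) (hL1 : 1 ≤ L) (β : ℝ) (len : Site 4 → ℝ) :
    ∃ i : ZdIdx 4 L, IdxB8LawsB L i ∧ DomainSeq L i.Ω ∧ i.Ω 0 = Set.univ ∧ i.Ω = OmegaHS (0 : Fin 4) ∧
      ¬ B8SectGH.Prop7PrintedR (fun _ : Unit => zdGF3P₂ 𝔸 L β len i) (fun _ => toAxialTower 𝔸 L β len hL1 i) :=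
  not_prop7PrintedR_zdGF3HP₂_toAxialTower_halfspace_cstar 𝔸 L hL hL1 β len

/-- The same on the P-carrier `zdGF3HP` (NODE 00's `famB8OfRecordSubBP` members; fields `rfl`-equal), every nontrivial C⋆-algebra, every `L ≥ 3`.
[cite: Balaban1985RegularSpaces, Prop. 7 (1.144)–(1.145) p.100, (1.35) p.82] -/
theorem not_prop7PrintedR_zdGF3HP_toAxialTower_halfspace_cstar (L : ℕ) (hL : 3 ≤ L) (hL1 : 1 ≤ L) (β : ℝ) (len : Site 4 → ℝ) :
    ∃ i : ZdIdx 4 L, IdxB8LawsB L i ∧ DomainSeq L i.Ω ∧ i.Ω 0 = Set.univ ∧ i.Ω = OmegaHS (0 : Fin 4) ∧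
      ¬ B8SectGH.Prop7PrintedR (fun _ : Unit => zdGF3HP 𝔸 L β len i) (fun _ => toAxialTower 𝔸 L β len hL1 i) :=
  not_prop7PrintedR_zdGF3HP₂_toAxialTower_halfspace_cstar 𝔸 L hL hL1 β len

/-- The same on the P-carrier `zdGF3P` (fields `rfl`-equal), every nontrivial C⋆-algebra, every `L ≥ 3`. [cite: Balaban1985RegularSpaces, Prop. 7 (1.144)–(1.145) p.100, (1.35) p.82] -/
theorem not_prop7PrintedR_zdGF3P_toAxialTower_halfspace_cstar (L : ℕ) (hL : 3 ≤ L) (hL1 : 1 ≤ L) (β : ℝ) (len : Site 4 → ℝ) :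
    ∃ i : ZdIdx 4 L, IdxB8LawsB L i ∧ DomainSeq L i.Ω ∧ i.Ω 0 = Set.univ ∧ i.Ω = OmegaHS (0 : Fin 4) ∧
      ¬ B8SectGH.Prop7PrintedR (fun _ : Unit => zdGF3P 𝔸 L β len i) (fun _ => toAxialTower 𝔸 L β len hL1 i) :=
  not_prop7PrintedR_zdGF3HP₂_toAxialTower_halfspace_cstar 𝔸 L hL hL1 β len

/-- **The `d`-keyed form** (the certificate at a lattice dimension `d` GIVEN AS A LETTER with `d = 4` — the shape a record reads at `d := θ.D`): a lawful admissible member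
`i : ZdIdx d L` with `Ω₀ = ℤᵈ` at which the typed-printed Proposition 7 on `zdGF3HP₂ 𝔸 L β len i` with `toAxialTower` fails. [cite: Balaban1985RegularSpaces, Prop. 7 (1.143)–(1.145) p.100, (1.3)–(1.4) p.77] -/
theorem not_prop7PrintedR_zdGF3HP₂_toAxialTower_cstar_dim {d : ℕ} (hd : d = 4) (L : ℕ) (hL : 3 ≤ L) (hL1 : 1 ≤ L) (β : ℝ) (len : Site d → ℝ) :
    ∃ i : ZdIdx d L, IdxB8LawsB L i ∧ DomainSeq L i.Ω ∧ i.Ω 0 = Set.univ ∧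
      ¬ B8SectGH.Prop7PrintedR (fun _ : Unit => zdGF3HP₂ 𝔸 L β len i) (fun _ => toAxialTower 𝔸 L β len hL1 i) := by
  subst hd
  obtain ⟨i, hlaws, hadm, hΩ0, -, hnot⟩ := not_prop7PrintedR_zdGF3HP₂_toAxialTower_halfspace_cstar 𝔸 L hL hL1 β len
  exact ⟨i, hlaws, hadm, hΩ0, hnot⟩

end Printed

/-! ## §2 The record faces at EVERY `θ : Node00.Stage3Params` with `θ.D = 4` (any coefficient algebra `θ.𝔸`) -/

section Record

variable (θ : Stage3Params) (hD : θ.D = 4) (β : ℝ) (len : Site θ.D → ℝ)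

/-- `3 ≤ θ.L` and `1 ≤ θ.L` (Bałaban's block size is odd `> 1`). [cite: Balaban1987RG1, p.253 («L an odd positive integer»), bookkeeping] -/
private theorem three_le_L : 3 ≤ θ.L ∧ 1 ≤ θ.L := by
  obtain ⟨⟨k, hk⟩, h1⟩ := θ.hL
  exact ⟨by omega, by omega⟩

include hD in
/-- ★ **A MEMBER OF THE «P₂C» SLOT's INDEX AT WHICH THE TYPED-PRINTED PROPOSITION 7 ALREADY FAILS, AT EVERY RECORD `θ` WITH `θ.D = 4`** (any `θ.𝔸`, `β`, `len`): a lawful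
admissible member `j : IdxB8SubC θ` for which `B8SectGH.Prop7PrintedR` of the one-member family `famB8OfRecordSubBP₂C θ β len j` with print's pinned map `toAxialTowerResid θ β len j.1.1`
is FALSE. [cite: Balaban1985RegularSpaces, Prop. 7 (1.143)–(1.145) p.100, (1.3)–(1.4) p.77, p.77] -/
theorem exists_idxB8SubC_not_prop7PrintedR :
    ∃ j : IdxB8SubC θ, ¬ B8SectGH.Prop7PrintedR (fun _ : Unit => famB8OfRecordSubBP₂C θ β len j) (fun _ => toAxialTowerResid θ β len j.1.1) := by
  obtain ⟨hL, hL1⟩ := three_le_L θ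
  obtain ⟨i, hlaws, hadm, hΩ0, hnot⟩ := not_prop7PrintedR_zdGF3HP₂_toAxialTower_cstar_dim θ.𝔸 hD θ.L hL hL1 β len
  exact ⟨⟨⟨⟨i, hΩ0⟩, hlaws⟩, hadm⟩, hnot⟩

include hD in
/-- ★★ **THE K1 RECORD KNITS' `p7` BINDER WITH THE AXIAL MAP PINNED IS FALSE AT EVERY RECORD `θ` WITH `θ.D = 4`** (any coefficient algebra `θ.𝔸`, e.g. `M_N(ℂ)`; any `β`, `len`):
`¬ B8SectGH.Prop7PrintedR (fun j : IdxB8SubB θ => famB8OfRecordSubBP θ β len j) (fun j => toAxialTowerResid θ β len j.1)` — the displayed conjunct of `Node00.Record13CarriersB8SubBPCoPH`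
(and its CoP ∕ CoPR ∕ X-view twins) at `λ.toAxial := toAxialTowerResid θ λ.β λ.len`.  By restriction of the family index (`B8LeafKnit.prop7PrintedR_precomp`) to the member of
`exists_idxB8SubC_not_prop7PrintedR`. [cite: Balaban1985RegularSpaces, Prop. 7 (1.143)–(1.145) p.100, (1.35) p.82, p.77] -/
theorem not_prop7PrintedR_famB8OfRecordSubBP_toAxialTowerResid :
    ¬ B8SectGH.Prop7PrintedR (fun j : IdxB8SubB θ => famB8OfRecordSubBP θ β len j) (fun j => toAxialTowerResid θ β len j.1) := by
  obtain ⟨j, hnot⟩ := exists_idxB8SubC_not_prop7PrintedR θ hD β len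
  exact fun h => hnot (prop7PrintedR_precomp (fun _ : Unit => j.1) _ _ h)

include hD in
/-- ★★ **… AND OVER THE «P₂C» SLOT's INDEX** `IdxB8SubC θ` (family `famB8OfRecordSubBP₂C θ β len`, map `fun j => toAxialTowerResid θ β len j.1.1` — the pinned data of
`Node00.CarriersB8SubBP2C`), every `θ` with `θ.D = 4`. [cite: Balaban1985RegularSpaces, Prop. 7 (1.143)–(1.145) p.100, (1.3)–(1.4) p.77] -/
theorem not_prop7PrintedR_famB8OfRecordSubBP₂C_toAxialTowerResid :
    ¬ B8SectGH.Prop7PrintedR (fun j : IdxB8SubC θ => famB8OfRecordSubBP₂C θ β len j) (fun j => toAxialTowerResid θ β len j.1.1) := by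
  obtain ⟨j, hnot⟩ := exists_idxB8SubC_not_prop7PrintedR θ hD β len
  exact fun h => hnot (prop7PrintedR_precomp (fun _ : Unit => j) _ _ h)

include hD in
/-- **… AND OVER THE ADMISSIBLE SUBTYPE** `{j : IdxB8SubB θ ∕∕ DomainSeq θ.L j.1.1.Ω}` of n05-w1's `B8Prop7TowerAxialRecordP` faces, every `θ` with `θ.D = 4`.
[cite: Balaban1985RegularSpaces, Prop. 7 (1.143)–(1.145) p.100, (1.3)–(1.4) p.77] -/
theorem not_prop7PrintedR_famB8OfRecordSubBP_domainSeq_toAxialTowerResid :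
    ¬ B8SectGH.Prop7PrintedR (fun j : {j : IdxB8SubB θ // DomainSeq θ.L j.1.1.Ω} => famB8OfRecordSubBP θ β len j.1)
      (fun j => toAxialTowerResid θ β len j.1.1) := by
  obtain ⟨j, hnot⟩ := exists_idxB8SubC_not_prop7PrintedR θ hD β len
  exact fun h => hnot (prop7PrintedR_precomp (fun _ : Unit => (⟨j.1, j.2⟩ : {j : IdxB8SubB θ // DomainSeq θ.L j.1.1.Ω})) _ _ h)

include hD in
/-- ★ **THE RS-CURRENCY LEAF OVER THE PINNED «P₂C» DATA IS UNINHABITED AT EVERY RECORD `θ` WITH `θ.D = 4`** — for ALL residual constants and carriers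
`C₂ B₁′ B₀′ B₁ B₂ c₁ inp B₀β loc lan cub`: `¬ B8LeafKnitRS.B8LeafRS θ.D θ.L … (fun j : IdxB8SubC θ => famB8OfRecordSubBP₂C θ β len j) lan cub (fun j => toAxialTowerResid θ β len j.1.1)`
(its `p7` field is the refuted conjunct) — the hypothesis of `Node00.CarriersB8SubBP2C.b8LeafOfRecordSubBP₂C_of_b8LeafRS_pinned` has no instance at any such `θ`.
[cite: Balaban1985RegularSpaces, Lemma 1 – Thm 8 pp.79–101 (the leaf), Prop. 7 (1.145) p.100] -/
theorem not_b8LeafRS_famB8OfRecordSubBP₂C_toAxialTowerResid {I₁ I₃ I₄ : Type} (C₂ B₁' B₀' B₁ B₂ c₁ : ℝ) (inp : B8.B9Inputs) (B₀β : ℝ)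
    (loc : I₁ → B8.LocalData) (lan : I₃ → B8.LandauData) (cub : I₄ → B8.CubeData) :
    ¬ B8LeafRS θ.D (θ.L : ℝ) C₂ B₁' B₀' B₁ B₂ c₁ inp B₀β loc (fun j : IdxB8SubC θ => famB8OfRecordSubBP₂C θ β len j) lan cub
      (fun j => toAxialTowerResid θ β len j.1.1) :=
  fun h => not_prop7PrintedR_famB8OfRecordSubBP₂C_toAxialTowerResid θ hD β len h.p7

include hD in
/-- … and over the P-members of the whole four-law sub-index `IdxB8SubB θ` (family `famB8OfRecordSubBP`, map `fun j => toAxialTowerResid θ β len j.1`), every `θ` with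
`θ.D = 4`. [cite: Balaban1985RegularSpaces, Lemma 1 – Thm 8 pp.79–101 (the leaf), Prop. 7 (1.145) p.100] -/
theorem not_b8LeafRS_famB8OfRecordSubBP_toAxialTowerResid {I₁ I₃ I₄ : Type} (C₂ B₁' B₀' B₁ B₂ c₁ : ℝ) (inp : B8.B9Inputs) (B₀β : ℝ)
    (loc : I₁ → B8.LocalData) (lan : I₃ → B8.LandauData) (cub : I₄ → B8.CubeData) :
    ¬ B8LeafRS θ.D (θ.L : ℝ) C₂ B₁' B₀' B₁ B₂ c₁ inp B₀β loc (fun j : IdxB8SubB θ => famB8OfRecordSubBP θ β len j) lan cub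
      (fun j => toAxialTowerResid θ β len j.1) :=
  fun h => not_prop7PrintedR_famB8OfRecordSubBP_toAxialTowerResid θ hD β len h.p7

end Record

end Literature.MathematicalPhysics.QuantumFieldTheory.Balaban1983to89.B8Prop7PrintedRZdGF3P2HalfSpaceCStar

end
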